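import Summits.QuantumFields.YangMills.Theorems.UnitScaleTiltProp7LaplaceAFlatCoercive
import Summits.QuantumFields.YangMills.Theorems.UnitScaleTiltProp7SectET3DeltaOneT3PInv
import Summits.QuantumFields.YangMills.Theorems.UnitScaleTiltProp7Row74AtMemberT3
import HarnessLib

/-!
# Route `UnitScaleTilt`, crux «MinimiserStabilityRegPr» (stmt-QuantumFields-19200, stub EX), node N06(d = 3), route (α) — **THE POSITIVITY ROWS `hPosπ` ∕ `hPos₁`
# OF THE EX DISPLAY (S42ᴸ ✓p729698) ARE EXACTLY «THE WILSON HESSIAN (+ J-TERM) PLUS THE AVERAGING PENALTY IS POSITIVE ON THE GAUGE-FIXED SUBSPACE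
# `{R_S(U₀) D*_{U₀} A = 0}`»** — [Balaban1985BackgroundPropagators] (3.118)–(3.122) ∕ (3.127)–(3.128) read as an EQUIVALENCE, at EVERY background `U₀` and every `0 ≤ a`

Cell `ym3-torus` (HUMAN RULING D-0037, YM ladder rung R3 — YM₃ on T³ is a RUNG, NOT d = 4, NOT the Clay problem; the YM mass gap is NOT proved).  Fleet lead seat
`ym-ust-19200-p1` (gen 21).  THEOREMS ONLY (0 `def`, 0 `sorry`); `--supports stmt-QuantumFields-19200 --as helper`; count-neutral.  NOTHING of [B9] §3's analysis is
asserted or proved: the file is finite-dimensional linear algebra over the landed bricks L0a (`Prop7SectET3HilbertLetters`), L0c (`Prop7SectET3GaugeProjector`: `N_S`, `R_S`),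
L0b-P (`Prop7SectET3DeltaPiPInv`: `Pᴾ = 1 − D G′ᴾ R_S D*`, `Δ_πᴾ = Pᴾ†Δ^ηPᴾ`; `Prop7SectET3DeltaOnePInv`: `Δ₁ᴾ(T_J) = Pᴾ†(Δ^η + T_J)Pᴾ`) and L0d (`laplaceA = Δx + D R_S D* + Q*aQ`).

THE PRINT.  [Balaban1985BackgroundPropagators] p. 419 (3.118)–(3.120): *«We represent A ∈ L² as A = A′ + Dλ, λ = G′RD*A … RD*A′ = 0 … ⟨A, Δ_πA⟩ = ⟨A′, ΔA′⟩»*; p. 420 (3.122)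
*«G⁻¹ = Δ_π + DRD* + Q*aQ»*; p. 421 (3.127)–(3.128) (`Δ₁ = Pᵀ(Δ + T_J)P`, `G₁`); Thm 3.11 p. 416 *«the operators Δ′_a, G′, (Q′G′²Q′*)⁻¹, Δ_a, G are positive definite»*.

WHAT IS PROVED (ns `…Theorems.Prop7PosOfGaugeFixed`; member `F n K`, `h : n ≤ K`, weights `c₀ cB > 0`, `0 ≤ a`, ANY background `U₀`, ANY J-term slot `T_J`).
* §1 ★ `exists_gauge_decomposition` — (3.118) at the pinv letters: every `x` is `x = Pᴾx + D_{U₀}λ` with `λ ∈ N_S(U₀)` and `R_S D* x = Δ^η_{U₀}λ`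
  (✓`exists_mem_NS_RS_eq` ∘ ✓`DL2_GprimeP_covLapSite_of_mem_NS`).
* §2 `Qk_DL2_of_mem_NS` ((3.115): `Q_k(Dλ) = 0` on `N_S`), ★ `Qk_gaugeCorrP` (`Q_k(Pᴾx) = Q_k x`), ★ `DstarL2_gaugeCorrP` (`D*(Pᴾx) = (1 − R_S)D*x`),
  ★ `RS_DstarL2_gaugeCorrP` (`R_S D*(Pᴾx) = 0` — «RD*A′ = 0»); `Pᴾ` is the identity on the gauge-fixed subspace by ✓`Prop7Row74AtMember.gaugeCorrP_eq_self_of_landau` (px21, reused).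
* §3 ★ `re_inner_laplaceA_DeltaOneP` — THE THREE-TERM FORM: `re⟨x, Δ_a(Δ₁ᴾ(T_J))x⟩ = re⟨Pᴾx, (Δ^η + T_J)(Pᴾx)⟩ + ‖R_S D* x‖² + a‖Q_k x‖²` (over ✓`re_inner_laplaceA`).
* §4 ★★★ `pos_laplaceA_DeltaOneP_of_gaugeFixed` ∕ ★★ `gaugeFixed_pos_of_pos_laplaceA_DeltaOneP` ∕ ★★★ `pos_laplaceA_DeltaOneP_iff` —
  `(∀ x ≠ 0, 0 < re⟨x, laplaceA … (DeltaOneP … T_J) U₀ x⟩) ↔ (∀ A ≠ 0, R_S(U₀)(D*_{U₀}A) = 0 → 0 < re⟨A, Δ^η(U₀)A + T_J(U₀)A⟩ + a·‖Q_k(U₀)A‖²)`: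
  the «if» direction splits `x = Pᴾx + Dλ` — for `Pᴾx ≠ 0` the hypothesis applies at `A := Pᴾx` (gauge-fixed by §2, `Q_kPᴾx = Q_kx`), for `Pᴾx = 0` the penalty
  `‖R_S D* x‖² = ‖Δ^ηλ‖²` is positive because `Dλ = x ≠ 0` and `⟨λ, Δ^ηλ⟩ = ‖Dλ‖²`; the «only if» direction is `Pᴾ A = A` on the slice.
* §5 the two EX slots: ★★★ `pos_laplaceA_DeltaPiSlotP_iff` (`T_J := 0`, ✓`DeltaOneP_zero`: the `hPosπ` slot) and ★★★ `pos_laplaceA_DeltaOnePJ_iff` (`T_J := TJSlotP`: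
  the `hPos₁` slot `DeltaOnePJ`); ★ `posOnto_DeltaOneP_of_gaugeFixed` (the class `PosOnto` of brick L0d from the gauge-fixed positivity + ✓`surjective_Qk_of_regPr`
  on `RegPr ρ U₀`, `13·10¹⁴·L³·ρ ≤ 1`).
* §6 THE DISPLAY ROWS IN GAUGE-FIXED SHAPE: ★★ `hPosπ_of_gaugeFixedRow` ∕ ★★ `hPos₁_of_gaugeFixedRow` — the S42ᴸ rows `hPosπ` ∕ `hPos₁` VERBATIM follow from (and, by §4,
  are equivalent member by member to) the rows «`∀ ρ ≤ αcap L`, `RegPr ρ U₀ →` positivity of `Δ^η(U₀) (+ T_J(U₀)) + a Q_k†Q_k` on `{R_S D* A = 0}`».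
* §7 the QUANTITATIVE form: `sq_norm_DL2_le_covLapSite` (`μ‖λ‖² ≤ ‖Dλ‖² ⇒ μ‖Dλ‖² ≤ ‖Δ^ηλ‖²`) and ★★★ `coercive_laplaceA_DeltaOneP_of_gaugeFixed` — a coercivity floor `γ`
  on the gauge-fixed subspace and a floor `μ` of `Δ^η_{U₀}` on `N_S(U₀)` (the `L²` bound of `G′`, Thm 3.3) give `(min γ μ ∕ 2)·‖x‖² ≤ re⟨x, Δ_a(U₀)x⟩` for all `x`
  (the coercivity-row shape of ★★OWNER RULING g28-№13 ∕ the HESS lane's `hco`).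
EFFECT (numbers, not adjectives): for two of the thirteen [B9] print rows the `DG′ᴾR_SD*` bookkeeping of (3.119) is REMOVED from what a supplier must prove; the flat
instance of the gauge-fixed row is ✓`Prop7LaplaceAFlatCoercive.coercive_laplaceA_one_piSlot` read through §4.  What a supplier still owes for `hPosπ` is Thm 3.11's
content proper: the curved-background coercivity of `‖D_{U₀}A‖² + ⟨A, Δ′A⟩ + a‖Q_kA‖²` on the gauge-fixed subspace under `RegPr ρ U₀` ([B9] (3.10), Lemma 3.1, §C).
HONEST SCOPE.  Linear algebra; no estimate; `hPosπ`, `hPos₁`, `hPosΔ`, the other ten print rows, `hThm2S`, EX, the crux are NOT proved; nothing continuum ∕ OS ∕ mass-gap ∕ Clay.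

References: T. Bałaban, CMP **99** (1985) 389–434 [Balaban1985BackgroundPropagators] ((3.115) p.418, (3.118)–(3.122) pp.419–420, (3.127)–(3.128) p.421, Thm 3.11 p.416,
(3.21)–(3.26) pp.394–395); CMP **102** (1985) 277–309 [Balaban1985Variational] ((110) p.294, (141)–(142) p.299).
-/

set_option autoImplicit false

noncomputable section

open scoped InnerProductSpace ComplexConjugate Matrix.Norms.L2Operator

namespace Summit.QuantumFields.YangMills.Theorems.Prop7PosOfGaugeFixed

open Literature.MathematicalPhysics.QuantumFieldTheory.Balaban1983to89
open Literature.MathematicalPhysics.QuantumFieldTheory.Balaban1983to89.T3ContinuumYM3Torus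
open Literature.MathematicalPhysics.QuantumFieldTheory.Balaban1983to89.T3PrintedRegularMinimiser (RegPr)
open Literature.MathematicalPhysics.QuantumFieldTheory.Balaban1983to89.T3Thm1Carrier (Idx)
open T3SectALandauChart (eta eta_pos)
open B9Eq311L2Pairing (WL2)
open B11Eq103H1Complex (SiteL2K BondL2K)
open Summit.QuantumFields.YangMills.Theorems.Prop7SectET3Transport (periodsT3)
open Summit.QuantumFields.YangMills.Theorems.Prop7SectET3HilbertLetters (W₂ QL2 DL2 DstarL2 covLapSite adjoint_DL2 inner_covLapSite)
open Summit.QuantumFields.YangMills.Theorems.Prop7SectET3GaugeProjector (QDS NS RS mem_NS_iff exists_mem_NS_RS_eq RS_apply_covLapSite_of_mem RS_RS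
  RS_isSymmetric QL2_DL2_eq_zero_of_mem_NS)
open Summit.QuantumFields.YangMills.Theorems.Prop7SectET3WilsonHessian (DeltaEta)
open Summit.QuantumFields.YangMills.Theorems.Prop7SectET3CurvedPropagators (Qk laplaceA PosOnto)
open Summit.QuantumFields.YangMills.Theorems.Prop7SectET3DeltaPiPInv (gaugeCorrP DeltaPiSlotP gaugeCorrP_apply DL2_GprimeP_covLapSite_of_mem_NS)
open Summit.QuantumFields.YangMills.Theorems.Prop7SectET3DeltaOnePInv (DeltaOneP TJSlotP DeltaOnePJ inner_DeltaOneP DeltaOneP_zero)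
open Summit.QuantumFields.YangMills.Theorems.Prop7LaplaceAFlatCoercive (re_inner_laplaceA)

variable {F : T3Family} {n K : ℕ} {h : n ≤ K} {c₀ cB a : ℝ} [Fact (0 < c₀)] [Fact (0 < cB)]

/-! ## §1 (3.118): `x = Pᴾx + D_{U₀}λ`, `λ ∈ N_S(U₀)`, `R_S D* x = Δ^η λ` -/

/-- ★ **(3.118) AT THE PINV LETTERS, EVERY BACKGROUND**: for `0 ≤ a`, every vector field `x` splits as `x = Pᴾ(U₀)x + D_{U₀}λ` with `λ ∈ N_S(U₀)` a residual gauge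
parameter such that `R_S(U₀)(D*_{U₀}x) = Δ^η_{U₀}λ` («A = A′ + Dλ, λ = G′RD*A»). [cite: Balaban1985BackgroundPropagators, (3.118) p.419, (3.22) p.394] -/
theorem exists_gauge_decomposition (ha : 0 ≤ a) (U₀ : GaugeField (F.P K) 0 (Matrix.specialUnitaryGroup (Fin 2) ℂ)) (x : BondL2K ℂ 3 (periodsT3 F K) c₀ W₂) :
    ∃ l ∈ NS F n K h c₀ cB U₀, x = gaugeCorrP F n K h c₀ cB a U₀ x + DL2 F n K c₀ U₀ l ∧
      RS F n K h c₀ cB U₀ (DstarL2 F n K c₀ U₀ x) = covLapSite F n K c₀ U₀ l := by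
  obtain ⟨l, hl, hR⟩ := exists_mem_NS_RS_eq (h := h) (cB := cB) U₀ (DstarL2 F n K c₀ U₀ x)
  refine ⟨l, hl, ?_, hR⟩
  rw [gaugeCorrP_apply, hR, DL2_GprimeP_covLapSite_of_mem_NS ha U₀ hl, sub_add_cancel]

/-! ## §2 The gauge-fixed component `Pᴾx`: same averages, `R_S D*(Pᴾx) = 0` -/

omit [Fact (0 < cB)] in
/-- **(3.115): `Q_k(U₀)(D_{U₀}λ) = 0` for `λ ∈ N_S(U₀)`** — print's `Q_k` in A-units is `η • Q(U₀)` (brick L0d), and `Q(U₀)∘D_{U₀}` vanishes on `N_S` by construction.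
[cite: Balaban1985BackgroundPropagators, (3.115) p.418] -/
theorem Qk_DL2_of_mem_NS (U₀ : GaugeField (F.P K) 0 (Matrix.specialUnitaryGroup (Fin 2) ℂ)) {l : SiteL2K ℂ 3 (periodsT3 F K) c₀ W₂}
    (hl : l ∈ NS F n K h c₀ cB U₀) : Qk F n K h c₀ cB U₀ (DL2 F n K c₀ U₀ l) = 0 := by
  show (((eta F n K : ℝ) : ℂ)) • QL2 F n K h c₀ cB U₀ (DL2 F n K c₀ U₀ l) = 0
  rw [QL2_DL2_eq_zero_of_mem_NS U₀ hl, smul_zero]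

/-- ★ **`Q_k(U₀)(Pᴾx) = Q_k(U₀)x`** — the gauge correction does not change the averages («the averages QA are invariant with respect to gauge transformations
λ ∈ N(Q′)», p. 418). [cite: Balaban1985BackgroundPropagators, (3.115) p.418, (3.118) p.419] -/
theorem Qk_gaugeCorrP (ha : 0 ≤ a) (U₀ : GaugeField (F.P K) 0 (Matrix.specialUnitaryGroup (Fin 2) ℂ)) (x : BondL2K ℂ 3 (periodsT3 F K) c₀ W₂) :
    Qk F n K h c₀ cB U₀ (gaugeCorrP F n K h c₀ cB a U₀ x) = Qk F n K h c₀ cB U₀ x := by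
  obtain ⟨l, hl, hx, -⟩ := exists_gauge_decomposition (h := h) (cB := cB) ha U₀ x
  have e : Qk F n K h c₀ cB U₀ (gaugeCorrP F n K h c₀ cB a U₀ x) + Qk F n K h c₀ cB U₀ (DL2 F n K c₀ U₀ l) = Qk F n K h c₀ cB U₀ x := by
    rw [← map_add, ← hx]
  rwa [Qk_DL2_of_mem_NS U₀ hl, add_zero] at e

/-- ★ **`D*_{U₀}(Pᴾx) = D*_{U₀}x − R_S(U₀)(D*_{U₀}x)`** (`D*Dλ = Δ^ηλ = R_S D* x`). [cite: Balaban1985BackgroundPropagators, (3.118) p.419, (3.23) p.394] -/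
theorem DstarL2_gaugeCorrP (ha : 0 ≤ a) (U₀ : GaugeField (F.P K) 0 (Matrix.specialUnitaryGroup (Fin 2) ℂ)) (x : BondL2K ℂ 3 (periodsT3 F K) c₀ W₂) :
    DstarL2 F n K c₀ U₀ (gaugeCorrP F n K h c₀ cB a U₀ x) = DstarL2 F n K c₀ U₀ x - RS F n K h c₀ cB U₀ (DstarL2 F n K c₀ U₀ x) := by
  obtain ⟨l, hl, hx, hR⟩ := exists_gauge_decomposition (h := h) (cB := cB) ha U₀ x
  have e : DstarL2 F n K c₀ U₀ (gaugeCorrP F n K h c₀ cB a U₀ x) + DstarL2 F n K c₀ U₀ (DL2 F n K c₀ U₀ l) = DstarL2 F n K c₀ U₀ x := by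
    rw [← map_add, ← hx]
  have hc : covLapSite F n K c₀ U₀ l = DstarL2 F n K c₀ U₀ (DL2 F n K c₀ U₀ l) := rfl
  rw [hR, hc, eq_sub_iff_add_eq]
  exact e

/-- ★ **«RD*A′ = 0» (p. 419): THE GAUGE-CORRECTED FIELD IS GAUGE-FIXED, `R_S(U₀)(D*_{U₀}(Pᴾx)) = 0`** (`R_S` is a projection, ✓`RS_RS`).
[cite: Balaban1985BackgroundPropagators, (3.118)–(3.119) p.419] -/
theorem RS_DstarL2_gaugeCorrP (ha : 0 ≤ a) (U₀ : GaugeField (F.P K) 0 (Matrix.specialUnitaryGroup (Fin 2) ℂ)) (x : BondL2K ℂ 3 (periodsT3 F K) c₀ W₂) :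
    RS F n K h c₀ cB U₀ (DstarL2 F n K c₀ U₀ (gaugeCorrP F n K h c₀ cB a U₀ x)) = 0 := by
  rw [DstarL2_gaugeCorrP ha U₀ x, map_sub, RS_RS, sub_self]

/-! ## §3 The three-term form of `Δ_a` at the slot `Δ₁ᴾ(T_J) = Pᴾ†(Δ^η + T_J)Pᴾ` -/

/-- ★ **`re⟨x, Δ_a(U₀)x⟩ = re⟨Pᴾx, (Δ^η(U₀) + T_J(U₀))(Pᴾx)⟩ + ‖R_S(U₀) D*_{U₀} x‖² + a·‖Q_k(U₀)x‖²`** for brick L0d's `laplaceA` at the slot `DeltaOneP T_J`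
((3.122) with (3.119)∕(3.128); ✓`re_inner_laplaceA`, ✓`inner_DeltaOneP`). [cite: Balaban1985BackgroundPropagators, (3.119) p.419, (3.122) p.420, (3.128) p.421] -/
theorem re_inner_laplaceA_DeltaOneP
    (TJ : GaugeField (F.P K) 0 (Matrix.specialUnitaryGroup (Fin 2) ℂ) → (BondL2K ℂ 3 (periodsT3 F K) c₀ W₂ →ₗ[ℂ] BondL2K ℂ 3 (periodsT3 F K) c₀ W₂))
    (U₀ : GaugeField (F.P K) 0 (Matrix.specialUnitaryGroup (Fin 2) ℂ)) (x : BondL2K ℂ 3 (periodsT3 F K) c₀ W₂) :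
    RCLike.re ⟪x, laplaceA F n K h c₀ cB a (DeltaOneP F n K h c₀ cB a TJ) U₀ x⟫_ℂ
      = RCLike.re ⟪gaugeCorrP F n K h c₀ cB a U₀ x,
            DeltaEta F n K c₀ U₀ (gaugeCorrP F n K h c₀ cB a U₀ x) + TJ U₀ (gaugeCorrP F n K h c₀ cB a U₀ x)⟫_ℂ
        + ‖RS F n K h c₀ cB U₀ (DstarL2 F n K c₀ U₀ x)‖ ^ 2 + a * ‖Qk F n K h c₀ cB U₀ x‖ ^ 2 := by
  rw [re_inner_laplaceA a (DeltaOneP F n K h c₀ cB a TJ) U₀ x, inner_DeltaOneP, inner_add_right]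

/-! ## §4 The equivalence: `Δ_a(Δ₁ᴾ(T_J))` positive definite ↔ `Δ^η + T_J + aQ_k†Q_k` positive on `{R_S D* A = 0}` -/

/-- ★★★ **GAUGE-FIXED POSITIVITY ⟹ `Δ_a` POSITIVE DEFINITE** (every background `U₀`, `0 ≤ a`, any J-term slot): if `0 < re⟨A, (Δ^η + T_J)A⟩ + a‖Q_kA‖²` for every
non-zero `A` with `R_S D* A = 0`, then `0 < re⟨x, Δ_a x⟩` for every `x ≠ 0`, `Δ_a = Δ₁ᴾ(T_J) + DR_SD* + Q*aQ`.  Proof: (3.118) `x = Pᴾx + Dλ`; if `Pᴾx ≠ 0` apply the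
hypothesis at `A := Pᴾx` (gauge-fixed, same averages); if `Pᴾx = 0` then `x = Dλ ≠ 0` and the penalty `‖R_S D*x‖² = ‖Δ^ηλ‖² > 0` since `⟨λ, Δ^ηλ⟩ = ‖Dλ‖²`.
[cite: Balaban1985BackgroundPropagators, Thm 3.11 p.416, (3.118)–(3.122) pp.419–420, (3.128) p.421] -/
theorem pos_laplaceA_DeltaOneP_of_gaugeFixed (ha : 0 ≤ a)
    (TJ : GaugeField (F.P K) 0 (Matrix.specialUnitaryGroup (Fin 2) ℂ) → (BondL2K ℂ 3 (periodsT3 F K) c₀ W₂ →ₗ[ℂ] BondL2K ℂ 3 (periodsT3 F K) c₀ W₂))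
    (U₀ : GaugeField (F.P K) 0 (Matrix.specialUnitaryGroup (Fin 2) ℂ))
    (hgf : ∀ A : BondL2K ℂ 3 (periodsT3 F K) c₀ W₂, A ≠ 0 → RS F n K h c₀ cB U₀ (DstarL2 F n K c₀ U₀ A) = 0 →
      0 < RCLike.re ⟪A, DeltaEta F n K c₀ U₀ A + TJ U₀ A⟫_ℂ + a * ‖Qk F n K h c₀ cB U₀ A‖ ^ 2) :
    ∀ x : BondL2K ℂ 3 (periodsT3 F K) c₀ W₂, x ≠ 0 →
      0 < RCLike.re ⟪x, laplaceA F n K h c₀ cB a (DeltaOneP F n K h c₀ cB a TJ) U₀ x⟫_ℂ := by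
  intro x hx
  rw [re_inner_laplaceA_DeltaOneP TJ U₀ x]
  obtain ⟨l, hl, hxd, hR⟩ := exists_gauge_decomposition (h := h) (cB := cB) ha U₀ x
  by_cases hP : gaugeCorrP F n K h c₀ cB a U₀ x = 0
  · -- pure gauge: `x = Dλ`, and `R_S D* x = Δ^η λ ≠ 0`
    rw [hP, zero_add] at hxd
    have hΔl : covLapSite F n K c₀ U₀ l ≠ 0 := by
      intro h0
      have hn : (((‖DL2 F n K c₀ U₀ l‖ : ℝ) : ℂ)) ^ 2 = 0 := by rw [← inner_covLapSite, h0, inner_zero_right]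
      have hn' : ‖DL2 F n K c₀ U₀ l‖ = 0 := Complex.ofReal_eq_zero.1 ((pow_eq_zero_iff two_ne_zero).1 hn)
      exact hx (hxd.trans (norm_eq_zero.1 hn'))
    have h2 : 0 < ‖RS F n K h c₀ cB U₀ (DstarL2 F n K c₀ U₀ x)‖ ^ 2 := by
      rw [hR]
      exact pow_pos (norm_pos_iff.2 hΔl) 2
    rw [hP, inner_zero_left, map_zero, zero_add]
    exact add_pos_of_pos_of_nonneg h2 (mul_nonneg ha (sq_nonneg _))
  · -- `Pᴾx ≠ 0`: the hypothesis at `A := Pᴾx`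
    have h1 := hgf (gaugeCorrP F n K h c₀ cB a U₀ x) hP (RS_DstarL2_gaugeCorrP ha U₀ x)
    rw [Qk_gaugeCorrP ha U₀ x] at h1
    have h2 : 0 ≤ ‖RS F n K h c₀ cB U₀ (DstarL2 F n K c₀ U₀ x)‖ ^ 2 := sq_nonneg _
    linarith

/-- ★★ **`Δ_a` POSITIVE DEFINITE ⟹ GAUGE-FIXED POSITIVITY** (the converse, every background): on the gauge-fixed subspace `Pᴾ A = A` and the `DR_SD*` penalty vanishes,
so `re⟨A, Δ_a A⟩ = re⟨A, (Δ^η + T_J)A⟩ + a‖Q_kA‖²` ([Balaban1985Variational] (79): «we have used again the fact that A′ satisfy the Landau gauge condition RD*A′ = 0»).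
[cite: Balaban1985BackgroundPropagators, (3.119) p.419, (3.122) p.420; Balaban1985Variational, (79) p.290] -/
theorem gaugeFixed_pos_of_pos_laplaceA_DeltaOneP
    (TJ : GaugeField (F.P K) 0 (Matrix.specialUnitaryGroup (Fin 2) ℂ) → (BondL2K ℂ 3 (periodsT3 F K) c₀ W₂ →ₗ[ℂ] BondL2K ℂ 3 (periodsT3 F K) c₀ W₂))
    (U₀ : GaugeField (F.P K) 0 (Matrix.specialUnitaryGroup (Fin 2) ℂ))
    (hpos : ∀ x : BondL2K ℂ 3 (periodsT3 F K) c₀ W₂, x ≠ 0 →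
      0 < RCLike.re ⟪x, laplaceA F n K h c₀ cB a (DeltaOneP F n K h c₀ cB a TJ) U₀ x⟫_ℂ) :
    ∀ A : BondL2K ℂ 3 (periodsT3 F K) c₀ W₂, A ≠ 0 → RS F n K h c₀ cB U₀ (DstarL2 F n K c₀ U₀ A) = 0 →
      0 < RCLike.re ⟪A, DeltaEta F n K c₀ U₀ A + TJ U₀ A⟫_ℂ + a * ‖Qk F n K h c₀ cB U₀ A‖ ^ 2 := by
  intro A hA hR
  have h1 := hpos A hA
  rw [re_inner_laplaceA_DeltaOneP TJ U₀ A, Prop7Row74AtMember.gaugeCorrP_eq_self_of_landau U₀ hR, hR, norm_zero, zero_pow two_ne_zero, add_zero] at h1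
  exact h1

/-- ★★★ **THE EQUIVALENCE** (every background `U₀`, `0 ≤ a`, any J-term slot `T_J`): `Δ_a(U₀) = Δ₁ᴾ(T_J)(U₀) + D R_S D* + Q*aQ` is positive definite iff
`Δ^η(U₀) + T_J(U₀) + a·Q_k†Q_k` is positive on the gauge-fixed subspace `{A : R_S(U₀) D*_{U₀} A = 0}`. [cite: Balaban1985BackgroundPropagators, Thm 3.11 p.416, (3.118)–(3.122) pp.419–420, (3.128) p.421] -/
theorem pos_laplaceA_DeltaOneP_iff (ha : 0 ≤ a)
    (TJ : GaugeField (F.P K) 0 (Matrix.specialUnitaryGroup (Fin 2) ℂ) → (BondL2K ℂ 3 (periodsT3 F K) c₀ W₂ →ₗ[ℂ] BondL2K ℂ 3 (periodsT3 F K) c₀ W₂))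
    (U₀ : GaugeField (F.P K) 0 (Matrix.specialUnitaryGroup (Fin 2) ℂ)) :
    (∀ x : BondL2K ℂ 3 (periodsT3 F K) c₀ W₂, x ≠ 0 →
        0 < RCLike.re ⟪x, laplaceA F n K h c₀ cB a (DeltaOneP F n K h c₀ cB a TJ) U₀ x⟫_ℂ) ↔
      (∀ A : BondL2K ℂ 3 (periodsT3 F K) c₀ W₂, A ≠ 0 → RS F n K h c₀ cB U₀ (DstarL2 F n K c₀ U₀ A) = 0 →
        0 < RCLike.re ⟪A, DeltaEta F n K c₀ U₀ A + TJ U₀ A⟫_ℂ + a * ‖Qk F n K h c₀ cB U₀ A‖ ^ 2) :=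
  ⟨gaugeFixed_pos_of_pos_laplaceA_DeltaOneP TJ U₀, pos_laplaceA_DeltaOneP_of_gaugeFixed ha TJ U₀⟩

/-! ## §5 The two EX slots `DeltaPiSlotP` (`hPosπ`) and `DeltaOnePJ` (`hPos₁`); the class `PosOnto` -/

/-- ★★★ **THE `hPosπ` SLOT** (`T_J := 0`, ✓`DeltaOneP_zero`): `Δ_a(U₀) = Δ_πᴾ(U₀) + DR_SD* + Q*aQ` is positive definite iff the Wilson Hessian plus the averaging
penalty, `Δ^η(U₀) + a·Q_k†Q_k`, is positive on `{R_S(U₀) D*_{U₀} A = 0}` — Thm 3.11's «Δ_a, G are positive definite» with the (3.119) bookkeeping removed.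
[cite: Balaban1985BackgroundPropagators, Thm 3.11 p.416, (3.119)–(3.122) pp.419–420] -/
theorem pos_laplaceA_DeltaPiSlotP_iff (ha : 0 ≤ a) (U₀ : GaugeField (F.P K) 0 (Matrix.specialUnitaryGroup (Fin 2) ℂ)) :
    (∀ x : BondL2K ℂ 3 (periodsT3 F K) c₀ W₂, x ≠ 0 →
        0 < RCLike.re ⟪x, laplaceA F n K h c₀ cB a (DeltaPiSlotP F n K h c₀ cB a) U₀ x⟫_ℂ) ↔
      (∀ A : BondL2K ℂ 3 (periodsT3 F K) c₀ W₂, A ≠ 0 → RS F n K h c₀ cB U₀ (DstarL2 F n K c₀ U₀ A) = 0 →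
        0 < RCLike.re ⟪A, DeltaEta F n K c₀ U₀ A⟫_ℂ + a * ‖Qk F n K h c₀ cB U₀ A‖ ^ 2) := by
  have e : DeltaPiSlotP F n K h c₀ cB a = DeltaOneP F n K h c₀ cB a (fun _ => 0) := DeltaOneP_zero.symm
  rw [e, pos_laplaceA_DeltaOneP_iff ha]
  simp only [LinearMap.zero_apply, add_zero]

/-- ★★★ **THE `hPos₁` SLOT** (`T_J := TJSlotP`, the J-term of record, so the slot is `DeltaOnePJ`): `Δ_{1,a}(U₀) = Δ₁ᴾ(U₀) + DR_SD* + Q*aQ` is positive definite iff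
`Δ^η(U₀) + T_J(U₀) + a·Q_k†Q_k` is positive on `{R_S(U₀) D*_{U₀} A = 0}` (p. 421: Thm 3.11 for `G` plus `‖G‖·‖T_J‖ < 1`).
[cite: Balaban1985BackgroundPropagators, (3.127)–(3.130) p.421, Thm 3.11 p.416] -/
theorem pos_laplaceA_DeltaOnePJ_iff (ha : 0 ≤ a) (U₀ : GaugeField (F.P K) 0 (Matrix.specialUnitaryGroup (Fin 2) ℂ)) :
    (∀ x : BondL2K ℂ 3 (periodsT3 F K) c₀ W₂, x ≠ 0 →
        0 < RCLike.re ⟪x, laplaceA F n K h c₀ cB a (DeltaOnePJ F n K h c₀ cB a) U₀ x⟫_ℂ) ↔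
      (∀ A : BondL2K ℂ 3 (periodsT3 F K) c₀ W₂, A ≠ 0 → RS F n K h c₀ cB U₀ (DstarL2 F n K c₀ U₀ A) = 0 →
        0 < RCLike.re ⟪A, DeltaEta F n K c₀ U₀ A + TJSlotP F n K h c₀ cB a U₀ A⟫_ℂ + a * ‖Qk F n K h c₀ cB U₀ A‖ ^ 2) :=
  pos_laplaceA_DeltaOneP_iff ha (TJSlotP F n K h c₀ cB a) U₀

/-- ★ **BRICK L0d's CLASS `PosOnto` FROM THE GAUGE-FIXED POSITIVITY ON `RegPr`** (`n < K`): positivity by §4, `Q_k(U₀)` onto by ✓`Prop7QkOntoOfRegPr.surjective_Qk_of_regPr`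
in the window `13·10¹⁴·L³·ρ ≤ 1` — so on such backgrounds the total letters `GT`, `KinvT`, `HT` of brick L0d ARE print's `G₁`, `(QG₁Q*)⁻¹`, `H₁` at the slot `Δ₁ᴾ(T_J)`.
[cite: Balaban1985BackgroundPropagators, Thm 3.11 p.416, (3.19) p.393, (3.126)–(3.129) pp.420–421] -/
theorem posOnto_DeltaOneP_of_gaugeFixed (hnK : n < K) (ha : 0 ≤ a)
    (TJ : GaugeField (F.P K) 0 (Matrix.specialUnitaryGroup (Fin 2) ℂ) → (BondL2K ℂ 3 (periodsT3 F K) c₀ W₂ →ₗ[ℂ] BondL2K ℂ 3 (periodsT3 F K) c₀ W₂))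
    {ρ : ℝ} {U₀ : GaugeField (F.P K) 0 (Matrix.specialUnitaryGroup (Fin 2) ℂ)} (hreg : RegPr F n K ρ U₀) (hwin : 13 * 10 ^ 14 * (F.L : ℝ) ^ 3 * ρ ≤ 1)
    (hgf : ∀ A : BondL2K ℂ 3 (periodsT3 F K) c₀ W₂, A ≠ 0 → RS F n K hnK.le c₀ cB U₀ (DstarL2 F n K c₀ U₀ A) = 0 →
      0 < RCLike.re ⟪A, DeltaEta F n K c₀ U₀ A + TJ U₀ A⟫_ℂ + a * ‖Qk F n K hnK.le c₀ cB U₀ A‖ ^ 2) :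
    PosOnto F n K hnK.le c₀ cB a (DeltaOneP F n K hnK.le c₀ cB a TJ) U₀ :=
  ⟨pos_laplaceA_DeltaOneP_of_gaugeFixed ha TJ U₀ hgf, Prop7QkOntoOfRegPr.surjective_Qk_of_regPr F hnK.le hnK c₀ cB hreg hwin⟩

/-! ## §6 The S42ᴸ rows `hPosπ` ∕ `hPos₁` from (equivalently: as) their gauge-fixed forms -/

/-- ★★ **THE EX DISPLAY ROW `hPosπ` (S42ᴸ ✓p729698, VERBATIM) FROM ITS GAUGE-FIXED FORM** — member by member the two are EQUIVALENT (§5); a supplier of the print row may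
therefore deliver «for `ρ ≤ αcap L` and `RegPr ρ U₀`: `0 < re⟨A, Δ^η(U₀)A⟩ + a·‖Q_k(U₀)A‖²` for all `A ≠ 0` with `R_S(U₀)D*_{U₀}A = 0`» instead.
[cite: Balaban1985BackgroundPropagators, Thm 3.11 p.416, (3.119)–(3.122) pp.419–420] -/
theorem hPosπ_of_gaugeFixedRow (αcap : ℕ → ℝ) (c₀ cB : ℕ → ℝ) [hc₀ : ∀ L : ℕ, Fact (0 < c₀ L)] [hcB : ∀ L : ℕ, Fact (0 < cB L)]
    (a : ∀ L : ℕ, Idx L → ℝ) (ha : ∀ (L : ℕ) (i : Idx L), 0 < a L i)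
    (hGF : ∀ (L : ℕ), 1 < L → ∀ (i : Idx L) (U₀ : GaugeField (i.1.1.P i.1.2.2) 0 (Matrix.specialUnitaryGroup (Fin 2) ℂ)), ∀ ρ : ℝ,
      RegPr i.1.1 i.1.2.1 i.1.2.2 ρ U₀ → ρ ≤ αcap L →
        ∀ A : BondL2K ℂ 3 (periodsT3 i.1.1 i.1.2.2) (c₀ L) W₂, A ≠ 0 →
          RS i.1.1 i.1.2.1 i.1.2.2 i.2.2.le (c₀ L) (cB L) U₀ (DstarL2 i.1.1 i.1.2.1 i.1.2.2 (c₀ L) U₀ A) = 0 →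
            0 < RCLike.re ⟪A, DeltaEta i.1.1 i.1.2.1 i.1.2.2 (c₀ L) U₀ A⟫_ℂ + a L i * ‖Qk i.1.1 i.1.2.1 i.1.2.2 i.2.2.le (c₀ L) (cB L) U₀ A‖ ^ 2) :
    ∀ (L : ℕ), 1 < L → ∀ (i : Idx L) (U₀ : GaugeField (i.1.1.P i.1.2.2) 0 (Matrix.specialUnitaryGroup (Fin 2) ℂ)), ∀ ρ : ℝ,
      RegPr i.1.1 i.1.2.1 i.1.2.2 ρ U₀ → ρ ≤ αcap L →
        ∀ x : BondL2K ℂ 3 (periodsT3 i.1.1 i.1.2.2) (c₀ L) W₂, x ≠ 0 →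
          0 < RCLike.re ⟪x, laplaceA i.1.1 i.1.2.1 i.1.2.2 i.2.2.le (c₀ L) (cB L) (a L i)
            (DeltaPiSlotP i.1.1 i.1.2.1 i.1.2.2 i.2.2.le (c₀ L) (cB L) (a L i)) U₀ x⟫_ℂ :=
  fun L hL i U₀ ρ hreg hρ => (pos_laplaceA_DeltaPiSlotP_iff (ha L i).le U₀).2 (hGF L hL i U₀ ρ hreg hρ)

/-- ★★ **THE EX DISPLAY ROW `hPos₁` (S42ᴸ ✓p729698, VERBATIM) FROM ITS GAUGE-FIXED FORM** (slot `DeltaOnePJ = Pᴾ†(Δ^η + T_J)Pᴾ`, J-term of record `TJSlotP`); member by member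
the two are EQUIVALENT (§5). [cite: Balaban1985BackgroundPropagators, (3.127)–(3.130) p.421, Thm 3.11 p.416] -/
theorem hPos₁_of_gaugeFixedRow (αcap : ℕ → ℝ) (c₀ cB : ℕ → ℝ) [hc₀ : ∀ L : ℕ, Fact (0 < c₀ L)] [hcB : ∀ L : ℕ, Fact (0 < cB L)]
    (a : ∀ L : ℕ, Idx L → ℝ) (ha : ∀ (L : ℕ) (i : Idx L), 0 < a L i)
    (hGF : ∀ (L : ℕ), 1 < L → ∀ (i : Idx L) (U₀ : GaugeField (i.1.1.P i.1.2.2) 0 (Matrix.specialUnitaryGroup (Fin 2) ℂ)), ∀ ρ : ℝ,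
      RegPr i.1.1 i.1.2.1 i.1.2.2 ρ U₀ → ρ ≤ αcap L →
        ∀ A : BondL2K ℂ 3 (periodsT3 i.1.1 i.1.2.2) (c₀ L) W₂, A ≠ 0 →
          RS i.1.1 i.1.2.1 i.1.2.2 i.2.2.le (c₀ L) (cB L) U₀ (DstarL2 i.1.1 i.1.2.1 i.1.2.2 (c₀ L) U₀ A) = 0 →
            0 < RCLike.re ⟪A, DeltaEta i.1.1 i.1.2.1 i.1.2.2 (c₀ L) U₀ A
                  + TJSlotP i.1.1 i.1.2.1 i.1.2.2 i.2.2.le (c₀ L) (cB L) (a L i) U₀ A⟫_ℂ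
              + a L i * ‖Qk i.1.1 i.1.2.1 i.1.2.2 i.2.2.le (c₀ L) (cB L) U₀ A‖ ^ 2) :
    ∀ (L : ℕ), 1 < L → ∀ (i : Idx L) (U₀ : GaugeField (i.1.1.P i.1.2.2) 0 (Matrix.specialUnitaryGroup (Fin 2) ℂ)), ∀ ρ : ℝ,
      RegPr i.1.1 i.1.2.1 i.1.2.2 ρ U₀ → ρ ≤ αcap L →
        ∀ x : BondL2K ℂ 3 (periodsT3 i.1.1 i.1.2.2) (c₀ L) W₂, x ≠ 0 →
          0 < RCLike.re ⟪x, laplaceA i.1.1 i.1.2.1 i.1.2.2 i.2.2.le (c₀ L) (cB L) (a L i)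
            (DeltaOnePJ i.1.1 i.1.2.1 i.1.2.2 i.2.2.le (c₀ L) (cB L) (a L i)) U₀ x⟫_ℂ :=
  fun L hL i U₀ ρ hreg hρ => (pos_laplaceA_DeltaOnePJ_iff (ha L i).le U₀).2 (hGF L hL i U₀ ρ hreg hρ)

/-! ## §7 The quantitative form: coercivity of `Δ_a` from gauge-fixed coercivity and the residual-gauge coercivity of `Δ^η` on `N_S` -/

omit [Fact (0 < cB)] in
/-- **`μ‖λ‖² ≤ ‖D_{U₀}λ‖² ⇒ μ‖D_{U₀}λ‖² ≤ ‖Δ^η_{U₀}λ‖²`** (`‖Dλ‖² = ⟨λ, Δ^ηλ⟩ ≤ ‖λ‖·‖Δ^ηλ‖`): a coercivity floor of `Δ^η_{U₀}` on a gauge parameter passes to its gradient —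
the `L²` form of «`G′ = (Δ′_a)⁻¹` bounded» ((3.24)–(3.25), Thm 3.3 for `G′`) read on the pure-gauge modes. [cite: Balaban1985BackgroundPropagators, (3.23)–(3.25) p.394, Thm 3.3 p.399] -/
theorem sq_norm_DL2_le_covLapSite (U₀ : GaugeField (F.P K) 0 (Matrix.specialUnitaryGroup (Fin 2) ℂ)) {l : SiteL2K ℂ 3 (periodsT3 F K) c₀ W₂} {μ : ℝ}
    (hμ : 0 < μ) (hco : μ * ‖l‖ ^ 2 ≤ ‖DL2 F n K c₀ U₀ l‖ ^ 2) : μ * ‖DL2 F n K c₀ U₀ l‖ ^ 2 ≤ ‖covLapSite F n K c₀ U₀ l‖ ^ 2 := by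
  have h1 : ‖DL2 F n K c₀ U₀ l‖ ^ 2 ≤ ‖l‖ * ‖covLapSite F n K c₀ U₀ l‖ := by
    have e : ‖⟪l, covLapSite F n K c₀ U₀ l⟫_ℂ‖ = ‖DL2 F n K c₀ U₀ l‖ ^ 2 := by
      rw [inner_covLapSite, norm_pow, Complex.norm_real, Real.norm_of_nonneg (norm_nonneg _)]
    rw [← e]
    exact norm_inner_le_norm l _
  have h2 : μ * ‖l‖ ^ 2 ≤ ‖l‖ * ‖covLapSite F n K c₀ U₀ l‖ := hco.trans h1
  by_cases hl : l = 0
  · subst hl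
    rw [map_zero, norm_zero]
    simp
  · have hlpos : 0 < ‖l‖ := norm_pos_iff.2 hl
    have h3 : μ * ‖l‖ ≤ ‖covLapSite F n K c₀ U₀ l‖ := by
      have h2' : (μ * ‖l‖) * ‖l‖ ≤ ‖covLapSite F n K c₀ U₀ l‖ * ‖l‖ := by nlinarith [h2]
      exact le_of_mul_le_mul_right h2' hlpos
    calc μ * ‖DL2 F n K c₀ U₀ l‖ ^ 2 ≤ μ * (‖l‖ * ‖covLapSite F n K c₀ U₀ l‖) := mul_le_mul_of_nonneg_left h1 hμ.le
      _ = (μ * ‖l‖) * ‖covLapSite F n K c₀ U₀ l‖ := by ring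
      _ ≤ ‖covLapSite F n K c₀ U₀ l‖ * ‖covLapSite F n K c₀ U₀ l‖ := mul_le_mul_of_nonneg_right h3 (norm_nonneg _)
      _ = ‖covLapSite F n K c₀ U₀ l‖ ^ 2 := by ring

/-- ★★★ **THE COERCIVITY ROW FOR `Δ_a` FROM TWO SLICE ROWS** (every background `U₀`, `0 ≤ a`, any J-term slot `T_J`): if `γ‖A‖² ≤ re⟨A, (Δ^η + T_J)A⟩ + a‖Q_kA‖²` on the
gauge-fixed subspace `{R_S D* A = 0}` and `μ‖λ‖² ≤ ‖D_{U₀}λ‖²` on the residual gauge algebra `N_S(U₀)` (`0 ≤ γ`, `0 < μ`), then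
`(min γ μ ∕ 2)·‖x‖² ≤ re⟨x, Δ_a(U₀)x⟩` for ALL `x` — the shape the HESS ∕ E′ lanes display (★★OWNER RULING g28-№13 «`γ(L)·‖y‖² ≤ re⟪y, Δ_a(W) y⟫`»), by
`x = Pᴾx + Dλ`, `‖x‖² ≤ 2‖Pᴾx‖² + 2‖Dλ‖²`, §3 and `sq_norm_DL2_le_covLapSite`. [cite: Balaban1985BackgroundPropagators, Thm 3.11 p.416, (3.118)–(3.122) pp.419–420, Thm 3.3 p.399; Balaban1985Variational, (141)–(142) p.299] -/
theorem coercive_laplaceA_DeltaOneP_of_gaugeFixed (ha : 0 ≤ a)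
    (TJ : GaugeField (F.P K) 0 (Matrix.specialUnitaryGroup (Fin 2) ℂ) → (BondL2K ℂ 3 (periodsT3 F K) c₀ W₂ →ₗ[ℂ] BondL2K ℂ 3 (periodsT3 F K) c₀ W₂))
    (U₀ : GaugeField (F.P K) 0 (Matrix.specialUnitaryGroup (Fin 2) ℂ)) {γ μ : ℝ} (hγ : 0 ≤ γ) (hμ : 0 < μ)
    (hgf : ∀ A : BondL2K ℂ 3 (periodsT3 F K) c₀ W₂, RS F n K h c₀ cB U₀ (DstarL2 F n K c₀ U₀ A) = 0 →
      γ * ‖A‖ ^ 2 ≤ RCLike.re ⟪A, DeltaEta F n K c₀ U₀ A + TJ U₀ A⟫_ℂ + a * ‖Qk F n K h c₀ cB U₀ A‖ ^ 2)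
    (hNS : ∀ l ∈ NS F n K h c₀ cB U₀, μ * ‖l‖ ^ 2 ≤ ‖DL2 F n K c₀ U₀ l‖ ^ 2) :
    ∀ x : BondL2K ℂ 3 (periodsT3 F K) c₀ W₂,
      min γ μ / 2 * ‖x‖ ^ 2 ≤ RCLike.re ⟪x, laplaceA F n K h c₀ cB a (DeltaOneP F n K h c₀ cB a TJ) U₀ x⟫_ℂ := by
  intro x
  rw [re_inner_laplaceA_DeltaOneP TJ U₀ x]
  obtain ⟨l, hl, hxd, hR⟩ := exists_gauge_decomposition (h := h) (cB := cB) ha U₀ x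
  have h1 := hgf (gaugeCorrP F n K h c₀ cB a U₀ x) (RS_DstarL2_gaugeCorrP ha U₀ x)
  rw [Qk_gaugeCorrP ha U₀ x] at h1
  have h2 : μ * ‖DL2 F n K c₀ U₀ l‖ ^ 2 ≤ ‖RS F n K h c₀ cB U₀ (DstarL2 F n K c₀ U₀ x)‖ ^ 2 := by
    rw [hR]
    exact sq_norm_DL2_le_covLapSite U₀ hμ (hNS l hl)
  have h3 : ‖x‖ ^ 2 ≤ 2 * ‖gaugeCorrP F n K h c₀ cB a U₀ x‖ ^ 2 + 2 * ‖DL2 F n K c₀ U₀ l‖ ^ 2 := by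
    have htri := norm_add_le (gaugeCorrP F n K h c₀ cB a U₀ x) (DL2 F n K c₀ U₀ l)
    rw [← hxd] at htri
    nlinarith [norm_nonneg (gaugeCorrP F n K h c₀ cB a U₀ x), norm_nonneg (DL2 F n K c₀ U₀ l), norm_nonneg x,
      sq_nonneg (‖gaugeCorrP F n K h c₀ cB a U₀ x‖ - ‖DL2 F n K c₀ U₀ l‖)]
  have hm1 : min γ μ ≤ γ := min_le_left _ _
  have hm2 : min γ μ ≤ μ := min_le_right _ _
  have hm0 : 0 ≤ min γ μ := le_min hγ hμ.le
  calc min γ μ / 2 * ‖x‖ ^ 2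
      ≤ min γ μ / 2 * (2 * ‖gaugeCorrP F n K h c₀ cB a U₀ x‖ ^ 2 + 2 * ‖DL2 F n K c₀ U₀ l‖ ^ 2) :=
        mul_le_mul_of_nonneg_left h3 (by positivity)
    _ = min γ μ * ‖gaugeCorrP F n K h c₀ cB a U₀ x‖ ^ 2 + min γ μ * ‖DL2 F n K c₀ U₀ l‖ ^ 2 := by ring
    _ ≤ γ * ‖gaugeCorrP F n K h c₀ cB a U₀ x‖ ^ 2 + μ * ‖DL2 F n K c₀ U₀ l‖ ^ 2 :=
        add_le_add (mul_le_mul_of_nonneg_right hm1 (sq_nonneg _)) (mul_le_mul_of_nonneg_right hm2 (sq_nonneg _))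
    _ ≤ (RCLike.re ⟪gaugeCorrP F n K h c₀ cB a U₀ x,
            DeltaEta F n K c₀ U₀ (gaugeCorrP F n K h c₀ cB a U₀ x) + TJ U₀ (gaugeCorrP F n K h c₀ cB a U₀ x)⟫_ℂ
          + a * ‖Qk F n K h c₀ cB U₀ x‖ ^ 2) + ‖RS F n K h c₀ cB U₀ (DstarL2 F n K c₀ U₀ x)‖ ^ 2 := add_le_add h1 h2
    _ = _ := by ring

end Summit.QuantumFields.YangMills.Theorems.Prop7PosOfGaugeFixed

end
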